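import Mathlib
import HarnessLib
import HarnessLib.Audit
import Summits.Langlands.Statement
import Literature.NumberTheory.Automorphic.GaloisActionPlaces
import Literature.NumberTheory.Automorphic.UnitaryGroupAutomorphicRep
import Literature.NumberTheory.Automorphic.UnitaryLimitsOfDiscreteSeries
import Literature.NumberTheory.Automorphic.UnitaryGroupLimitOfDiscreteSeriesAt
import Literature.NumberTheory.Automorphic.TunnellOctahedralGlobal
import Literature.NumberTheory.Automorphic.BaseChangeInductionAlong
import Literature.NumberTheory.Automorphic.AutomorphicLFunction
import Literature.NumberTheory.Automorphic.AsaiSign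
import HarnessLib.Audit.Status.Attr

/-!
Route: QuadraticWindow

DORMANT since 2026-08-24T21:46:17Z (reconciler: no traction for 7.1 d (last activity item-evidence-added at 2026-08-17T18:50:40Z); parked, not closed — `ledger route dormant route-Langlands-QuadraticWindow --off` to reactivate) — unstaffed, not closed; items shared with open routes are served there. `ledger route dormant <id> --off` reactivates.

Route QuadraticWindow — realises idea card quadratic-window-unitary-lds ("the quadratic window").
THESIS X = QuadraticWindowA (route item; rev 3 restated over the summit cone, elaborated in the
planner's Sketch.lean, lean check rc 0): for every totally real F₀, every quadratic extension F/F₀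
with nontrivial automorphism τ (the NEW case is F of mixed signature, e.g. ℚ(2^{1/4})/ℚ(√2); F
totally real or CM is the accepted named fact lang.S27), every n, every cuspidal regular algebraic π
of GL_n(𝔸_F) which is τ-POLARIZED — π^τ ≅ π^∨ ⊗ η∘N_{F/F₀}∘det for an algebraic Hecke character η =
χ·‖·‖^{−k} of F₀, stated almost everywhere on Satake parameters through the ARTIN AVATAR e : Γ_{F₀}
→ GL_1(ℂ) of the finite-order part χ (its arithmetic-Frobenius value c_v at v, `e.HasFrobCharpolyAt
v (X − C c_v)`) and the norm exponent k : ℤ, i.e. Sat(π,τw) = Sat(π,w)⁻¹·(c_v q_v^k)^{f(w|v)} — NOT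
τ-invariant (so AI_{F/F₀}(π) is cuspidal), PARITY-NORMALISED (rev 3, all n): w ↦ det e(c_w) (=
η_v(−1) = ±1, c_w a complex conjugation of Γ_F at a real place w of F; the real places of F lie
exactly over the real places of F₀ that split in F) is constant — typed as `(e.restrictField
F).IsOdd ∨ (all +1)` — and equal to −1 when n is odd (both WLOG up to a finite-order twist: support
TwistNormalization), and every prime ℓ unramified in F with π unramified above ℓ, ι : ℚ̄_ℓ ≃ ℂ:
there is a semisimple ρ : Γ_F → GL_n(ℚ̄_ℓ) whose arithmetic Frobenius at all but finitely many
places w has characteristic polynomial ∏_j (X − ι⁻¹((q_w^{(n−1)/2} α_j)⁻¹)) (α = Satake parameter of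
π at w; the convention of
`Literature.NumberTheory.Automorphic.exists_galoisRep_of_regularAlgebraic`).
Lean: ∀ F₀ F τ, IsTotallyReal F₀ → finrank F₀ F = 2 → τ ≠ 1 → ∀ n hcpt (π :
CuspidalAutomorphicRepData n F hcpt) (e : FramedGaloisRep F₀ ℂ 1) (k : ℤ), π.1.IsRegularAlgebraic →
[τ-polarized a.e. w.r.t. (e,k)] → ((e.restrictField F).IsOdd ∨ [det (e|Γ_F)(c) = 1 at every complex
conjugation c of a real place of F]) → (Odd n → (e.restrictField F).IsOdd) → [∃ᶠ w, Sat(π,τw) ≠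
Sat(π,w)] → ∀ ℓ ι, ¬ ℓ ∣ discr F → (π unramified above ℓ) → ∃ ρ : FramedGaloisRep F (PadicAlgCl ℓ)
n, ρ.toGaloisRep.IsSemisimple ∧ ∀ᶠ w, ∀ α, π.1.HasSatakeParamAt w α → ρ.IsUnramifiedAt w ∧
ρ.HasFrobCharpolyAt w (arithFrobPolyOfSatake ι w.residueCard n α)   (bracketed hypotheses abbreviate
the displayed clauses of the item QuadraticWindowA, which is the verbatim Prop).
RELATION TO THE SUMMIT: X is a new instance of the Satake clause of conjunct (A)
`Summit.Langlands.AutomorphicToGalois`, for base fields over which no instance with n ≥ 3 is known.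
Deciding theorem (rev 3, text unchanged at rev 4): `closes : HostInducedRep → TwistUnpackaging →
BeyondTheWindow → Langlands` — three hypotheses, ALL CRUX ITEMS since rev 4 (judge repair
2026-08-16, bridge-only / sector-complement-as-support finding): BeyondTheWindow := QuadraticWindowA
→ Langlands is the DECLARED RESIDUAL CRUX — the summit outside the window (every other (F, n, π);
inside the window ℓ | level, local–global compatibility at every finite place, de Rham,
irreducibility, direction (B)), summit-strength modulo X by the landed certificate
`langlands_iff_quadraticWindowA_and_beyondTheWindow : Langlands ↔ QuadraticWindowA ∧
BeyondTheWindow` (p85108; sandwich lemmas p83390), hence the weakest adequate residual; it is ranked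
LAST, carries three prover verdicts `open-problem`, closes only with the summit and is not where
this route directs provers — it is a crux so that the route's complete uncertainty is exactly its
crux list (D-0027 §2.2). The mathematical content of the glue is "HostInducedRep + TwistUnpackaging
⟹ X" (instantiation: TwistUnpackaging's twist-family hypothesis is HostInducedRep's conclusion);
TwistUnpackaging is PROVED (`Summit.Langlands.Langlands.Theorems.TwistUnpackaging_proof`,
2026-08-16) and so is the optional item Assembly (`Theorems/QuadraticWindowAssembly.lean`), so the
live uncertainty is HostInducedRep (the bet) + BeyondTheWindow (the declared residual).
TYPING (rev 3, cone repair): beyond the summit statement the route imports only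
`Literature.NumberTheory.Automorphic.GaloisActionPlaces` (proved; τ • w on finite places); Hecke
characters enter through their Artin avatars `FramedGaloisRep _ ℂ 1` (finite image; class field
theory is used INSIDE proofs, never in statements), their values through `HasFrobCharpolyAt v (X − C
c)`, their signs at real places through `IsComplexConjugationAt` + `Matrix.GeneralLinearGroup.det`,
restriction to Γ_F through `restrictField`.

Rationale: WHY THIS LINE. Over a number field F that is neither totally real nor CM no Galois representation is
attached to any cusp form of GL_n, n ≥ 3 (Calegari arXiv:2109.14145 fn 57). Obstruction: weights of
π are base-changed from the maximal TR/CM subfield (Clozel purity + Raghuram arXiv:2207.03393 Prop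
2.6), so every transfer to a group WITH a Shimura variety has repeated Hodge–Tate weights. Card's
observation: for F QUADRATIC over totally real F₀ the multiplicity is EXACTLY 2, still audible to a
Hermitian host with K_∞ = U(n)×U(n): for τ-polarized π, AI_{F/F₀}(π) → BC to CM K, twist → Mok
descent (arXiv:1206.0882, any quadratic E/F, read p.10) → cuspidal π′ on quasi-split U_{K/F₀}(2n)
with NON-DEGENERATE LIMITS OF DISCRETE SERIES at ∞ (HC parameter (k|k), singular only at noncompact
roots) = the input of Goldring–Koskivirta's coherent-cohomology theorem (arXiv:1507.05032 Thm 3.5.5,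
read p.19) → r_K → untwist, patch over K, twist extraction (HST doi:10.1007/bf01232440, Taylor
doi:10.1007/bf01231575, BCGP arXiv:1812.09269 Thm 2.7 = the n=2 stratum) → ρ_π. Catalogue moves:
lift to a richer structure (borrow a Shimura variety after induction) + regime decomposition (the
window is exactly [F:F₀] = 2).
RANKED CRUXES. rank 3 (typed HostInducedRep; the top crux since retriage rev 2 demoted and rev 3
dropped the informal SignLaw): the engine output — for every admissible finite-order twist ψ of F
(Artin avatar eψ : Γ_F → GL_1(ℂ), unramified above ℓ, ψ_w(−1) = ψ_{τw}(−1) at the real places, π⊗ψ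
not τ-invariant) a semisimple R : Γ_{F₀} → GL_{2n}(ℚ̄_ℓ) which is UNRAMIFIED with Frobenius char
poly ∏_{w|v} P_w(X^{f(w|v)}) (P_w = arithFrobPolyOfSatake of Sat(π,w)·c_w, c_w = eψ(Frob_w)) at
EVERY v ∤ ℓ unramified in F above which π and ψ are unramified (CONTROLLED exceptional set, rev 3;
this is Ind(ρ_π⊗ẽψ⁻¹), the representation of AI_{F/F₀}(π⊗ψ⁻¹)); why it might fail: the descent of
Π_K must be a non-degenerate LDS at every real place (the archimedean sign law, ex-item SignLaw:
claim (ii) reduced on paper to Mok Thm 2.4.10 + 2.5.4(a) over F/F₀ itself, evidence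
SignLawViaMokF.md and the independent audit SignLawAuditGen2.md on stmt-Langlands-3254, LDS
dictionary unaudited; claim (i) is now the parity hypothesis of X), GK 3.5.5 needs quasi-split
GU(n,n) with B = K to be a unitary Kottwitz datum (Goldring 2014 §2, acq-02542), U→GU and patching
are untyped. rank 4 (typed TwistUnpackaging; PROVED 2026-08-16, `Theorems.TwistUnpackaging_proof`
over ten supporting modules — kept for the record): {R_ψ}_ψ ⟹ ρ_π with COFINITE matching — pure
Galois/character theory: Clifford + Brauer–Nesbitt + Chebotarev give A = R_1|Γ_F ≅ ρ ⊕ ρ^τ with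
density-one matching (Taylor 1994 §3, doi:10.1007/bf01231575), and the controlled sets of rev 3 let
one admissible ψ per good place w, unramified at w with generic ψ(ϖ_w)/ψ(ϖ_{τw}), separate the two
halves of {roots P_w} ∪ {roots P_{τw}} (with uncontrolled ψ-dependent sets this fails on a sparse
infinite set of w; Berger–Harcos doi:10.1093/imrn/rnm113 used an inertial marking at n = 2); why it
might fail: implied verbatim by X hence unrefutable as typed, and the CFT existence / Chebotarev /
Brauer–Nesbitt infrastructure is not in Mathlib (it did not: proved). rank LAST (BeyondTheWindow :=
QuadraticWindowA → Langlands; re-kinded support → crux at rev 4, judge repair 2026-08-16, so that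
every hypothesis of `closes` is a declared crux): the RESIDUAL of this sector route = the summit
outside the window (all other (F, n, π); ℓ | level, local–global compatibility at every finite
place, de Rham at ℓ, irreducibility/uniqueness, direction (B)); summit-strength modulo X and the
weakest adequate residual (certificates p83390 `beyondTheWindow_sandwich`, p85108
`langlands_iff_quadraticWindowA_and_beyondTheWindow : Langlands ↔ X ∧ BeyondTheWindow`, both landed
--supports stmt-Langlands-3202); why it might fail: it IS the open reciprocity conjecture for GL_n
outside one sector — no ρ_π is known at all for non-polarizable π over F neither CM nor totally
real, n ≥ 3 (Calegari2023 = arXiv:2109.14145 fn 57), direction (B) is Fontaine–Mazur–Langlands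
(FontaineMazurGeometric1995 Conj. 1; BuzzardGeeLMS2014 Conj. 3.2.1–3.2.2) — no engine is claimed and
none is pretended: it is NOT an easier form of anything, it closes only with the summit (the sub's
other routes attack other sectors), three prover verdicts `open-problem` stand on the item, and
provers must not be staffed on it; the route's bet, staffing, kill criteria and cheapest falsifier
are HostInducedRep's. ranks 5–7 (GaloisRepOfUnitaryLDS = Goldring–Koskivirta 2019 Thm 3.5.5,
AutomorphicInductionUnramified = cyclic automorphic induction with Hecke–Satake at every unramified
place, PartialAsaiLAtOne = Grbac–Shahidi 2015 Thm 4.3 at s = 1; promoted 2026-08-16 by the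
route-choice repair): the PRINTED INPUTS of HostInducedRep's engine — published theorems whose risk
is formalization debt (xl-apex), not mathematics; since rev 9 (route-repair unused-crux) they feed
`closes` through the support glue HostInducedRepOfPrintedInputs := GaloisRepOfUnitaryLDS →
AutomorphicInductionUnramified → PartialAsaiLAtOne → HostInducedRep, which the landed
`Theorems.HostInducedRep_proof_eleven` (line one-transparent-pane; uses AI + GS, not GK) closes
modulo nine non-apex named facts (lang.S27, Fakhruddin–Pilloni 9.10 Cont, Jacquet–Shalika SMO,
Arthur–Clozel BC + archimedean lifting, Hewitt–Ross extension, Henniart infinity type, Mok pin +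
dichotomy), while line grs-explicit-descent consumes GK + AI; `closes` itself is unchanged.
TYPING. rev 3 (cone repair): all 21 unproved facts of the route's import cone (Hecke/Tate L-function
continuation and functional equation, Artin conductor, …) rode in on the import
`Literature.NumberTheory.GaloisRepresentations.HeckeCharacter`, of which the items used only
DEFINITIONS (HeckeCharacter, valueAtUniformizer, infiniteIdeles, IsFiniteOrder, IsUnramifiedAt); the
four typed items are restated 1:1 over the summit cone — Hecke characters ↦ Artin avatars
(`FramedGaloisRep _ ℂ 1`; value at v via `HasFrobCharpolyAt v (X − C c)`; sign at a real place via
`IsComplexConjugationAt` + `Matrix.GeneralLinearGroup.det`; `restrictField F`; norm exponent k : ℤ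
for the algebraic polarization character η = χ‖·‖^{−k}, which is all an algebraic Hecke character of
a totally real field can be) — folding in the reviewers' standing repairs: parity constancy on split
real places for ALL n (X, HostInducedRep, TwistUnpackaging; TwistNormalization extended), ψ-parity
for all n, controlled exceptional sets. Every typed item is TRUE under reciprocity (HostInducedRep ⇐
(A) with local–global compatibility at unramified places via R = Ind(ρ_π ⊗ ẽψ⁻¹); TwistUnpackaging
concludes X's conclusion; n = 1 is the CFT/Weil calibration), so what grounders/refuters audit is
provability by the engine. No unitary-group / LDS API exists (summit is GL_n-only), so the host
chain stays compressed into its Galois-side output; GK 3.5.5 is a cite fact; the Asai-sign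
vocabulary (`Literature.NumberTheory.Automorphic.AsaiSign`) is deliberately NOT imported by the
route file (its cone carries unproved pair-L-function facts) and belongs to the layer-2 split / the
proofs.
KILL CRITERIA. (i) a parity-normalised τ-polarized regular algebraic cuspidal π (n ≥ 2) whose
K-descent is NOT a non-degenerate limit of discrete series at some real place (wrong Asai sign) ⇒
HostInducedRep's engine dead ⇒ restate X on the surviving sub-class or close; (ii) GK's
Kottwitz-datum hypotheses fail for (B = K, V = K^{2n}, signature (n,n)) ⇒ engine lost; (iii) a proof
that cofinite unpackaging needs inertial data not derivable from the controlled R_ψ ⇒ restate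
TwistUnpackaging with an inertial clause (repair, not death). Refutation of a typed item in Lean is
impossible by design (all are consequences of conjunct (A)); refuters grade provability and the
paper steps.
NOT DECOMPOSED YET: the host chain inside HostInducedRep — foreseen layer-2 glued split (AI+BC+twist
bookkeeping / Mok descent in NLDS weight incl. the sign law, typable over
`Literature.NumberTheory.Automorphic.AsaiSign` / GK 3.5.5 as a cite-level crux / patching + U→GU),
refuters ask for at least one typed layer-2 crux, tenure planner's call; the reviewer's ABSTRACT
form of TwistUnpackaging (over a.e.-defined Satake-type data w ↦ α_w instead of π, refutable
independently of reciprocity) — it needs `π unramified a.e.` moved into X's hypotheses to keep the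
glue fact-free, deferred to tenure; ℓ | level, full LGC, de Rham, direction (B) (sibling card
unitary-lds-patching-window) — all inside the declared residual crux BeyondTheWindow, which is
deliberately NOT decomposed; the density-one unpackaging is not filed separately.
CHEAPEST FALSIFIER. n = 2, F = ℚ(2^{1/4}) ⊃ F₀ = ℚ(√2): take a weight-0, parity-normalised,
τ-polarized non-base-change π on GL_2/F (BCGP arXiv:1812.09269 Thm 2.7 already supplies ρ_π, so the
OUTPUT is known) and check on paper that Π_K = BC_K(AI π)⊗ψ₀ descends to U_{K/F₀}(4) in
non-degenerate LDS weight at BOTH real places of F₀ (Mok 2.5.4(a) sign vs the (k|k) parameter): a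
mismatch kills HostInducedRep's engine at the first new rank; the even cheaper n = 1 instance
(CFT/Weil) calibrates conventions.

Novelty: NEAREST PRIOR (searched: lit hybrid; zbMATH ×3 → Carayol–Knapp 2007, Goldring
doi:10.1112/s0010437x13007355, Berger–Weiss arXiv:2009.13980; crossref → doi:10.1093/imrn/rnm113,
doi:10.1007/bf01231575, doi:10.1007/bf01232440; galaxy all "neither CM nor totally real" 0 hits, pdf
"non-degenerate limit of discrete series" 0; reads arXiv:1507.05032 p19, arXiv:1206.0882 pp10,20-21,
arXiv:1812.09269 pp3-4,23; + the card's and two refuter audits' searches). (1) arXiv:1812.09269 Thm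
2.7: GL_2 over ANY quadratic extension of a totally real field, weight 0, trivial central character,
via GSp_4 — same proof as (2) arXiv:1109.5392 (Mok, CM quadratic); template (3) HST
doi:10.1007/bf01232440 / Taylor doi:10.1007/bf01231575 (AI to totally real base, LDS host,
congruence-built r, twist extraction); engine (4) arXiv:1507.05032 Thm 3.5.5 (non-degenerate LDS,
unitary Shimura varieties) + (5) arXiv:2009.13980 (their oddness). DELTA: every rank n for the
τ-POLARIZED spectrum of a non-CM quadratic F/F₀ through the quasi-split host U_{K/F₀}(2n) (signature
(n,n) hears multiplicity-2 weights as non-degenerate LDS), isolating the genuinely new statement —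
the archimedean SIGN LAW for the doubled non-elliptic parameter (crux SignLaw) — and a typed
extraction statement; nothing found treats n ≥ 3 or unitary groups of non-CM quadratic extensions.
Expected grade new-combination (card so graded 2026-08-15).  [refs: 10.1112/s0010437x13007355, 10.1093/imrn/rnm113, 10.1007/bf01231575, 10.1007/bf01232440, 2009.13980, 1507.05032, 1206.0882, 1812.09269, 1109.5392, doi:10.1112/s0010437x13007355, doi:10.1093/imrn/rnm113, doi:10.1007/bf01231575, doi:10.1007/bf01232440]

Barriers (technique_class: automorphic-induction coherent-cohomology endoscopic-transfer): - Literature.Barriers.Langlands.ShimuraVarietyRealizationBarrier: evaded via its own scope caveat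
(transfer to another group): Res GL_n/F, U_{F/F₀}(n) (non-CM F) have no Shimura datum; after AI + BC
to CM K the package lives on GU_{K/F₀}(n,n), whose K_∞ = U(n)×U(n) hears doubled weights as
non-degenerate LDS (crux SignLaw decides if the descent lands there); outside the window
(multiplicity ≥ 3) the barrier stands.
- Literature.Barriers.Langlands.NonRegularWeightBarrier: entered on purpose, only its
non-degenerate-LDS stratum: strata Hasse invariants (arXiv:1507.05032) replace Betti/p-adic
interpolation; price accepted: ℓ good, semisimplified unramified compatibility only.
- Literature.Barriers.Langlands.TwistedEndoscopySelfDual: respected: descent GL_{2n}/K ⇝ U(2n) needs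
conjugate self-duality, hence τ-POLARIZED π only; non-polarizable π conceded. Its residual freedom,
the Asai SIGN of an irregular Π, is exactly crux SignLaw.
- Literature.Barriers.Langlands.SolvableImageBarrier,
Literature.Barriers.Langlands.SolvableImageBarrierNarrow: not engaged: only quadratic AI/BC
(Arthur–Clozel), no non-solvable descent.
- TaylorWiles*/Patching*/ResiduallyReducible/ModPLanglands*/Shtuka* barriers: not engaged by
direction (A); they re-enter in the sibling (B)-card unitary-lds-patching-window.
- Negatives index empty (2026-08-15); refuted cards even-artin-u22-coherent-window /
hermitian-cap-door-even-artin died of the archimedean sign obstruction = our rank-2 crux, not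
assumed away.

Novelty grade: new-combination — route-review gen-2 (refuter fb96e753-g2), incremental; gen-0 (6ccfe8e7)/gen-1 (13:47) verdicts STAND: typed decls rc0 (W2.lean); X -> TwistUnpackaging and Assembly proved as evidence; every typed item true under reciprocity by design; BeyondTheWindow = declared residual (rest of summit). GEN-2 DELTA (refuter refuter-rreview-route-QuantumAdvantage-D-fb96e753-g2-0, 2026-08-15T14:29:32Z; prior: arxiv:1812.09269,arxiv:1507.05032,arxiv:1206.0882,doi:10.1007/bf01231575,doi:10.1007/bf01232440)

History (route lifecycle, newest last):
- 2026-08-15T16:29:09Z · rev 3: restated QuadraticWindowA (stmt-Langlands-3198), HostInducedRep (stmt-Langlands-3199), TwistUnpackaging (stmt-Langlands-3200), TwistNormalization (stmt-Langlands-3201) — route-repair (planner rbadge gen-4): CONE REPAIR + GLUE + HYGIENE. imports := [Literature.NumberTheory.Automorphic.GaloisActionPlaces] — drops  (planner-rbadge-Langlands-QuadraticWindow-e5a24734-g4-0)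
- 2026-08-15T16:29:09Z · rev 3: dropped SignLaw — route-repair (planner rbadge gen-4): CONE REPAIR + GLUE + HYGIENE. imports := [Literature.NumberTheory.Automorphic.GaloisActionPlaces] — drops Literature.Number (planner-rbadge-Langlands-QuadraticWindow-e5a24734-g4-0)
- 2026-08-24T21:46:17Z · DORMANT — reconciler: no traction for 7.1 d (last activity item-evidence-added at 2026-08-17T18:50:40Z); parked, not closed — `ledger route dormant route-Langlands-Quadra (operator:999:1039613)

sub-problem: Langlands · status: dormant · opened planner-plancard-Langlands-Langlands-quadrati-c2f4716f-0 2026-08-15T11:12:51Z · rev 10 · ledger route-Langlands-QuadraticWindow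
GENERATED by the gate from the ledger (D-0016/17). Provers cite these decls: `theorem foo : Summit.Langlands.Langlands.Theses.QuadraticWindow.<Decl> := …` in Summits/Langlands/Langlands/Theorems/<Name>.lean.
-/

namespace Summit.Langlands.Langlands.Theses.QuadraticWindow

open scoped BigOperators Topology Manifold Classical MeasureTheory ProbabilityTheory Matrix InnerProductSpace ComplexConjugate ContinuousMap
open Filter Set Function TopologicalSpace MeasureTheory

attribute [summit_statement] _root_.Langlands

-- earlier QuadraticWindowA (stmt-Langlands-3198, replaced 2026-08-15T16:29:09Z -> stmt-Langlands-10901): retired by None — ∀ (F₀ F : Type) [Field F₀] [NumberField F₀] [Field F] [NumberField F] [Algebra F₀ F] (τ : F ≃ₐ[F₀] F), NumberField.IsTotallyReal F₀ → Module.finrank F₀ F = 2 → τ ≠ 1 → ∀ (n : ℕ) (hcpt : Literature.NumberTheory.Automorphic.isCompact_glFiniteIntegralLevel n F) (π : Literature.Numb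
/-- item stmt-Langlands-10901 · target · rank 0 · open · by planner
why it might fail: True under reciprocity (unrefutable; n=1 = CFT/Weil calibration). Reachability rests on HostInducedRep's engine (Asai sign => non-degenerate LDS descent; GK 3.5.5 Kottwitz datum for GU(n,n), B=K) and on cofinite unpackaging from CONTROLLED R_psi; l | level excluded.
sources: arXiv:1812.09269 Thm 2.7 (n=2 stratum), GoldringKoskivirta2019 Thm 3.5.5 (arXiv:1507.05032), arXiv:2109.14145 §12 fn 57, HarrisLanTaylorThorneRMS2016 (lang.S27 shape), arXiv:2207.03393 Prop 2.6, arXiv:1010.2561 §2.1, Lemma A.2.5 (parity of polarized pairs)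
[target] X of the card quadratic-window-unitary-lds, rev 3 (cone repair over the summit cone +
parity normalisation for all n). F₀ totally real, F/F₀ quadratic with nontrivial automorphism τ (new
case: F of mixed signature, e.g. ℚ(2^{1/4})/ℚ(√2)); π cuspidal regular algebraic on GL_n/F,
τ-POLARIZED a.e. on Satake parameters with respect to an algebraic Hecke character η = χ‖·‖^{−k} of
F₀ given by the ARTIN AVATAR e : Γ_{F₀} → GL_1(ℂ) of χ and k : ℤ: Sat(π,τ•w) = Sat(π,w)⁻¹·(c_v
q_v^k)^{f(w|v)} whenever c_v is the arithmetic-Frobenius value of e at v = w|F₀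
(`e.HasFrobCharpolyAt v (X − C c_v)`; vacuous at the finitely many ramified v), i.e. π^τ ≅ π^∨ ⊗
η∘N_{F/F₀}∘det by strong multiplicity one and class field theory (for τ-polarized regular algebraic
π the polarization character is algebraic by the archimedean comparison, and an algebraic Hecke
character of a totally real field is finite-order × integral norm power); PARITY-NORMALISED (all n):
w ↦ det e(c_w), c_w ∈ Γ_F a complex conjugation at a real place w of F (the real places of F are
exactly the places over the real places v of F₀ that split in F, and det e(c_w) = η_v(−1)), is
constant (typed as `(e.restrictField F).IsOdd ∨ ∀ φ -/
@[route_item "route-Langlands-QuadraticWindow"]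
def QuadraticWindowA : Prop :=
  ∀ (F₀ F : Type) [Field F₀] [NumberField F₀] [Field F] [NumberField F] [Algebra F₀ F] (τ : F ≃ₐ[F₀] F), NumberField.IsTotallyReal F₀ → Module.finrank F₀ F = 2 → τ ≠ 1 → ∀ (n : ℕ) (hcpt : Literature.NumberTheory.Automorphic.isCompact_glFiniteIntegralLevel n F) (π : Literature.NumberTheory.Automorphic.CuspidalAutomorphicRepData n F hcpt) (e : Literature.NumberTheory.GaloisRepresentations.FramedGaloisRep F₀ ℂ 1) (k : ℤ), π.1.IsRegularAlgebraic → (∀ᶠ w in Filter.cofinite, ∀ (α β : Multiset ℂ) (c : ℂ), π.1.HasSatakeParamAt w α → π.1.HasSatakeParamAt (τ • w) β → e.HasFrobCharpolyAt (w.under (NumberField.RingOfIntegers F₀)) (Polynomial.X - Polynomial.C c) → β = α.map (fun a ↦ a⁻¹ * (c * ((w.under (NumberField.RingOfIntegers F₀)).residueCard : ℂ) ^ k) ^ w.asIdeal.inertiaDeg (NumberField.RingOfIntegers F₀))) → ((e.restrictField F).IsOdd ∨ ∀ (φ : F →+* ℝ) (c : Field.absoluteGaloisGroup F), Literature.NumberTheory.GaloisRepresentations.IsComplexConjugation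 φ c → Matrix.GeneralLinearGroup.det ((e.restrictField F) c) = 1) → (Odd n → (e.restrictField F).IsOdd) → (∃ᶠ w in Filter.cofinite, ∃ α β : Multiset ℂ, π.1.HasSatakeParamAt w α ∧ π.1.HasSatakeParamAt (τ • w) β ∧ β ≠ α) → ∀ (ℓ : ℕ) [Fact ℓ.Prime] (ι : PadicAlgCl ℓ ≃+* ℂ), ¬ ((ℓ : ℤ) ∣ NumberField.discr F) → (∀ w : IsDedekindDomain.HeightOneSpectrum (NumberField.RingOfIntegers F), ((ℓ : ℕ) : NumberField.RingOfIntegers F) ∈ w.asIdeal → π.1.IsUnramifiedAt w) → ∃ ρ : Literature.NumberTheory.GaloisRepresentations.FramedGaloisRep F (PadicAlgCl ℓ) n, ρ.toGaloisRep.IsSemisimple ∧ ∀ᶠ w in Filter.cofinite, ∀ α : Multiset ℂ, π.1.HasSatakeParamAt w α → ρ.IsUnramifiedAt w ∧ ρ.HasFrobCharpolyAt w (Literature.NumberTheory.Automorphic.arithFrobPolyOfSatake ι w.residueCard n α)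

-- earlier HostInducedRep (stmt-Langlands-3199, replaced 2026-08-15T16:29:09Z -> stmt-Langlands-10902): retired by None — ∀ (F₀ F : Type) [Field F₀] [NumberField F₀] [Field F] [NumberField F] [Algebra F₀ F] (τ : F ≃ₐ[F₀] F), NumberField.IsTotallyReal F₀ → Module.finrank F₀ F = 2 → τ ≠ 1 → ∀ (n : ℕ) (hcpt : Literature.NumberTheory.Automorphic.isCompact_glFiniteIntegralLevel n F) (π : Literature.Number
/-- item stmt-Langlands-10902 · crux · rank 3 · open · by planner
why it might fail: (a) the descent of Pi_K may fail to be non-degenerate LDS at a real place (Asai sign; ex-SignLaw (ii), paper-reduced to Mok 2.4.10+2.5.4(a), LDS dictionary unaudited); (b) is quasi-split GU(n,n), B=K a unitary Kottwitz datum (GK 3.5.5)? (c) U->GU, patching; (d) control at ALL good v.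
sources: GoldringKoskivirta2019 Thm 3.5.5, §11.1 (arXiv:1507.05032, read chunks p0018-19, p0040), doi:10.1112/s0010437x13007355 §2 (Goldring 2014: unitary Kottwitz datum; acq-02542 open), Mok2014 Thm 2.4.10, Thm 2.5.2, Thm 2.5.4(a), Cor 2.5.5 (arXiv:1206.0882), Sorensen2020 (doi:10.1017/9781108649711.012), BarnetlambEtAl2014 Lemma A.2.5 (arXiv:1010.2561), ArthurClozelAMS120 Ch.3 Thm 6.2
[crux] HOST ENGINE OUTPUT over F₀ (rev 3: Artin avatars, ψ-parity for all n, CONTROLLED exceptional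
set). For π, (e,k) as in the target (regular algebraic, τ-polarized a.e., parity-normalised, ℓ ∤
disc F, π unramified above ℓ) and every finite-order Hecke character ψ of F given by its Artin
avatar eψ : Γ_F → GL_1(ℂ) — unramified above ℓ; ψ_w(−1) = ψ_{τw}(−1) at the real places (det eψ(c_w)
= det eψ(c_{τw})), so that π⊗ψ is again parity-normalised; π⊗ψ not τ-invariant, a.e.-robustly on the
twisted Satake parameters Sat(π,w)·c_w, c_w = eψ(Frob_w) via `HasFrobCharpolyAt w (X − C c_w)` —
there is a semisimple R : Γ_{F₀} → GL_{2n}(ℚ̄_ℓ) which at EVERY finite place v ∤ ℓ of F₀ that is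
unramified in F and above which π and eψ are unramified is unramified with arithmetic-Frobenius
characteristic polynomial ∏_{w|v} P_w(X^{f(w|v)}), P_w = arithFrobPolyOfSatake ι q_w n
(Sat(π,w)·c_w) — i.e. Ind_{Γ_F}^{Γ_{F₀}}(ρ_π ⊗ ẽψ⁻¹), the representation of AI_{F/F₀}(π⊗ψ⁻¹) (ẽψ =
ι⁻¹∘eψ; the family is inversion-symmetric, so the convention is immaterial). TRUE under the summit
(local–global compatibility at unramified places); the content is provability by the card's chain: Π
:= AI_{F/F₀}(π⊗ψ⁻¹) cuspidal o -/
@[route_item "route-Langlands-QuadraticWindow", crux]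
def HostInducedRep : Prop :=
  ∀ (F₀ F : Type) [Field F₀] [NumberField F₀] [Field F] [NumberField F] [Algebra F₀ F] (τ : F ≃ₐ[F₀] F), NumberField.IsTotallyReal F₀ → Module.finrank F₀ F = 2 → τ ≠ 1 → ∀ (n : ℕ) (hcpt : Literature.NumberTheory.Automorphic.isCompact_glFiniteIntegralLevel n F) (π : Literature.NumberTheory.Automorphic.CuspidalAutomorphicRepData n F hcpt) (e : Literature.NumberTheory.GaloisRepresentations.FramedGaloisRep F₀ ℂ 1) (k : ℤ), π.1.IsRegularAlgebraic → (∀ᶠ w in Filter.cofinite, ∀ (α β : Multiset ℂ) (c : ℂ), π.1.HasSatakeParamAt w α → π.1.HasSatakeParamAt (τ • w) β → e.HasFrobCharpolyAt (w.under (NumberField.RingOfIntegers F₀)) (Polynomial.X - Polynomial.C c) → β = α.map (fun a ↦ a⁻¹ * (c * ((w.under (NumberField.RingOfIntegers F₀)).residueCard : ℂ) ^ k) ^ w.asIdeal.inertiaDeg (NumberField.RingOfIntegers F₀))) → ((e.restrictField F).IsOdd ∨ ∀ (φ : F →+* ℝ) (c : Field.absoluteGaloisGroup F), Literature.NumberTheory.GaloisRepresentations.IsComplexConjugation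 φ c → Matrix.GeneralLinearGroup.det ((e.restrictField F) c) = 1) → (Odd n → (e.restrictField F).IsOdd) → ∀ (ℓ : ℕ) [Fact ℓ.Prime] (ι : PadicAlgCl ℓ ≃+* ℂ), ¬ ((ℓ : ℤ) ∣ NumberField.discr F) → (∀ w : IsDedekindDomain.HeightOneSpectrum (NumberField.RingOfIntegers F), ((ℓ : ℕ) : NumberField.RingOfIntegers F) ∈ w.asIdeal → π.1.IsUnramifiedAt w) → ∀ eψ : Literature.NumberTheory.GaloisRepresentations.FramedGaloisRep F ℂ 1, (∀ w : IsDedekindDomain.HeightOneSpectrum (NumberField.RingOfIntegers F), ((ℓ : ℕ) : NumberField.RingOfIntegers F) ∈ w.asIdeal → eψ.IsUnramifiedAt w) → (∀ (φ : F →+* ℝ) (c c' : Field.absoluteGaloisGroup F), Literature.NumberTheory.GaloisRepresentations.IsComplexConjugation φ c → Literature.NumberTheory.GaloisRepresentations.IsComplexConjugation (φ.comp (τ : F →+* F)) c' → Matrix.GeneralLinearGroup.det (eψ c) = Matrix.GeneralLinearGroup.det (eψ c')) → (∃ᶠ w in Filter.cofinite, ∃ (α β : Multiset ℂ) (c c'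 : ℂ), π.1.HasSatakeParamAt w α ∧ π.1.HasSatakeParamAt (τ • w) β ∧ eψ.HasFrobCharpolyAt w (Polynomial.X - Polynomial.C c) ∧ eψ.HasFrobCharpolyAt (τ • w) (Polynomial.X - Polynomial.C c') ∧ β.map (fun b ↦ b * c') ≠ α.map (fun a ↦ a * c)) → ∃ R : Literature.NumberTheory.GaloisRepresentations.FramedGaloisRep F₀ (PadicAlgCl ℓ) (2 * n), R.toGaloisRep.IsSemisimple ∧ ∀ (v : IsDedekindDomain.HeightOneSpectrum (NumberField.RingOfIntegers F₀)) (α : _ → Multiset ℂ) (c : _ → ℂ), ((ℓ : ℕ) : NumberField.RingOfIntegers F₀) ∉ v.asIdeal → (∀ w : IsDedekindDomain.HeightOneSpectrum (NumberField.RingOfIntegers F), w.under (NumberField.RingOfIntegers F₀) = v → w.asIdeal.ramificationIdx (NumberField.RingOfIntegers F₀) = 1 ∧ π.1.HasSatakeParamAt w (α w) ∧ eψ.IsUnramifiedAt w ∧ eψ.HasFrobCharpolyAt w (Polynomial.X - Polynomial.C (c w))) → R.IsUnramifiedAt v ∧ R.HasFrobCharpolyAt v (∏ᶠ w ∈ {w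 : IsDedekindDomain.HeightOneSpectrum (NumberField.RingOfIntegers F) | w.under (NumberField.RingOfIntegers F₀) = v}, Polynomial.expand (PadicAlgCl ℓ) (w.asIdeal.inertiaDeg (NumberField.RingOfIntegers F₀)) (Literature.NumberTheory.Automorphic.arithFrobPolyOfSatake ι w.residueCard n ((α w).map (fun a ↦ a * c w))))

-- earlier TwistUnpackaging (stmt-Langlands-3200, replaced 2026-08-15T16:29:09Z -> stmt-Langlands-10903): retired by None — ∀ (F₀ F : Type) [Field F₀] [NumberField F₀] [Field F] [NumberField F] [Algebra F₀ F] (τ : F ≃ₐ[F₀] F), NumberField.IsTotallyReal F₀ → Module.finrank F₀ F = 2 → τ ≠ 1 → ∀ (n : ℕ) (hcpt : Literature.NumberTheory.Automorphic.isCompact_glFiniteIntegralLevel n F) (π : Literature.Numb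
/-- item stmt-Langlands-10903 · crux · rank 4 · closed · proved by Summit.Langlands.Langlands.Theorems.TwistUnpackaging_proof @ b03e6b617908 (prover) · by planner
why it might fail: Implied verbatim by X (unrefutable as typed). As a theorem: Taylor 1994 sec. 3 gives density-one matching; the cofinite step needs at each good w an admissible psi unramified at w with generic psi(w)/psi(tau w) - CFT existence + Chebotarev/Brauer-Nesbitt/Clifford infrastructure not in Mathlib.
sources: Taylor1994 §3 (doi:10.1007/bf01231575), BergerHarcos2007 (doi:10.1093/imrn/rnm113), arXiv:1109.5392 §4-5 (Mok, GL2 over CM: twist extraction), arXiv:1812.09269 Thm 2.7 (GL2 over any quadratic extension of a totally real field, ss-LGC at w∤p), HarrisSoudryTaylor1993 (doi:10.1007/bf01232440), evidence stmt-Langlands-3203/W1Assembly.lean (X => TwistUnpackaging, assembly logic)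
[crux] EXTRACTION (pure Galois/character theory, no automorphic input beyond Satake data; rev 3:
Artin avatars, CONTROLLED family). If for every admissible ψ (Artin avatar eψ, exactly as in
HostInducedRep) the induced package R_ψ : Γ_{F₀} → GL_{2n}(ℚ̄_ℓ) exists — semisimple, unramified
with the induced characteristic polynomial at EVERY v ∤ ℓ unramified in F above which π and ψ are
unramified — then ρ_π : Γ_F → GL_n(ℚ̄_ℓ) exists with cofinite Satake–Frobenius matching. Sketch: A
:= R_1|_{Γ_F} (ψ = 1 is admissible because π is not τ-invariant), B_ψ := R_ψ|_{Γ_F}, with char polys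
P_w·P_{τw} resp. P_w[c_w]·P_{τw}[c_{τw}] at all good w; Taylor's virtual-character argument
(doi:10.1007/bf01231575 §3: for χ = ψ^τ/ψ, tr ρ(Frob_w) = ((tr B_ψ − ψ^τ·tr A)/(ψ − ψ^τ))(Frob_w)
off ker χ, and ⋂_ψ ker χ_ψ cuts out an infinite extension of F because F has a complex place) gives
a semisimple ρ with A ≅ ρ ⊕ ρ^τ and B_ψ ≅ ρ⊗ψ̃ ⊕ (ρ⊗ψ̃)^τ (Chebotarev + Brauer–Nesbitt); then at
EVERY good w one admissible ψ, unramified at w with ψ(ϖ_w)/ψ(ϖ_{τw}) outside a finite set, separates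
the two halves of the multiset {roots P_w} ∪ {roots P_{τw}} and gives charpoly ρ(Frob_w) = P_w —
this last step is exactly what -/
@[route_item "route-Langlands-QuadraticWindow", crux]
def TwistUnpackaging : Prop :=
  ∀ (F₀ F : Type) [Field F₀] [NumberField F₀] [Field F] [NumberField F] [Algebra F₀ F] (τ : F ≃ₐ[F₀] F), NumberField.IsTotallyReal F₀ → Module.finrank F₀ F = 2 → τ ≠ 1 → ∀ (n : ℕ) (hcpt : Literature.NumberTheory.Automorphic.isCompact_glFiniteIntegralLevel n F) (π : Literature.NumberTheory.Automorphic.CuspidalAutomorphicRepData n F hcpt) (e : Literature.NumberTheory.GaloisRepresentations.FramedGaloisRep F₀ ℂ 1) (k : ℤ), π.1.IsRegularAlgebraic → (∀ᶠ w in Filter.cofinite, ∀ (α β : Multiset ℂ) (c : ℂ), π.1.HasSatakeParamAt w α → π.1.HasSatakeParamAt (τ • w) β → e.HasFrobCharpolyAt (w.under (NumberField.RingOfIntegers F₀)) (Polynomial.X - Polynomial.C c) → β = α.map (fun a ↦ a⁻¹ * (c * ((w.under (NumberField.RingOfIntegers F₀)).residueCard : ℂ) ^ k) ^ w.asIdeal.inertiaDeg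 (NumberField.RingOfIntegers F₀))) → ((e.restrictField F).IsOdd ∨ ∀ (φ : F →+* ℝ) (c : Field.absoluteGaloisGroup F), Literature.NumberTheory.GaloisRepresentations.IsComplexConjugation φ c → Matrix.GeneralLinearGroup.det ((e.restrictField F) c) = 1) → (Odd n → (e.restrictField F).IsOdd) → (∃ᶠ w in Filter.cofinite, ∃ α β : Multiset ℂ, π.1.HasSatakeParamAt w α ∧ π.1.HasSatakeParamAt (τ • w) β ∧ β ≠ α) → ∀ (ℓ : ℕ) [Fact ℓ.Prime] (ι : PadicAlgCl ℓ ≃+* ℂ), ¬ ((ℓ : ℤ) ∣ NumberField.discr F) → (∀ w : IsDedekindDomain.HeightOneSpectrum (NumberField.RingOfIntegers F), ((ℓ : ℕ) : NumberField.RingOfIntegers F) ∈ w.asIdeal → π.1.IsUnramifiedAt w) → (∀ eψ : Literature.NumberTheory.GaloisRepresentations.FramedGaloisRep F ℂ 1, (∀ w : IsDedekindDomain.HeightOneSpectrum (NumberField.RingOfIntegers F), ((ℓ : ℕ) : NumberField.RingOfIntegers F) ∈ w.asIdeal → eψ.IsUnramifiedAt w) → (∀ (φ : F →+* ℝ) (c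 c' : Field.absoluteGaloisGroup F), Literature.NumberTheory.GaloisRepresentations.IsComplexConjugation φ c → Literature.NumberTheory.GaloisRepresentations.IsComplexConjugation (φ.comp (τ : F →+* F)) c' → Matrix.GeneralLinearGroup.det (eψ c) = Matrix.GeneralLinearGroup.det (eψ c')) → (∃ᶠ w in Filter.cofinite, ∃ (α β : Multiset ℂ) (c c' : ℂ), π.1.HasSatakeParamAt w α ∧ π.1.HasSatakeParamAt (τ • w) β ∧ eψ.HasFrobCharpolyAt w (Polynomial.X - Polynomial.C c) ∧ eψ.HasFrobCharpolyAt (τ • w) (Polynomial.X - Polynomial.C c') ∧ β.map (fun b ↦ b * c') ≠ α.map (fun a ↦ a * c)) → ∃ R : Literature.NumberTheory.GaloisRepresentations.FramedGaloisRep F₀ (PadicAlgCl ℓ) (2 * n), R.toGaloisRep.IsSemisimple ∧ ∀ (v : IsDedekindDomain.HeightOneSpectrum (NumberField.RingOfIntegers F₀)) (α : _ → Multiset ℂ) (c : _ → ℂ), ((ℓ : ℕ) : NumberField.RingOfIntegers F₀) ∉ v.asIdeal → (∀ w : IsDedekindDomain.HeightOneSpectrum (NumberField.RingOfIntegers F),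 w.under (NumberField.RingOfIntegers F₀) = v → w.asIdeal.ramificationIdx (NumberField.RingOfIntegers F₀) = 1 ∧ π.1.HasSatakeParamAt w (α w) ∧ eψ.IsUnramifiedAt w ∧ eψ.HasFrobCharpolyAt w (Polynomial.X - Polynomial.C (c w))) → R.IsUnramifiedAt v ∧ R.HasFrobCharpolyAt v (∏ᶠ w ∈ {w : IsDedekindDomain.HeightOneSpectrum (NumberField.RingOfIntegers F) | w.under (NumberField.RingOfIntegers F₀) = v}, Polynomial.expand (PadicAlgCl ℓ) (w.asIdeal.inertiaDeg (NumberField.RingOfIntegers F₀)) (Literature.NumberTheory.Automorphic.arithFrobPolyOfSatake ι w.residueCard n ((α w).map (fun a ↦ a * c w))))) → ∃ ρ : Literature.NumberTheory.GaloisRepresentations.FramedGaloisRep F (PadicAlgCl ℓ) n, ρ.toGaloisRep.IsSemisimple ∧ ∀ᶠ w in Filter.cofinite, ∀ α : Multiset ℂ, π.1.HasSatakeParamAt w α → ρ.IsUnramifiedAt w ∧ ρ.HasFrobCharpolyAt w (Literature.NumberTheory.Automorphic.arithFrobPolyOfSatake ι w.residueCard n α)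

/-- item stmt-Langlands-15129 · crux · rank 5 · open · by planner
why it might fail: Formalization debt (XL: integral models + coherent cohomology of unitary Shimura varieties, Hasse invariants, pseudo-reps, HLTT input; none in Mathlib), not maths. False AS TYPED only by a slip: ell=2 & odd N rest on PS16 Rem 3.12.1; U->GU at inert unramified p unprinted; thin UnitaryGroup pins.
sources: GoldringKoskivirta2019 Thm 3.5.5 (arXiv:1507.05032 p.19), §2.1.3 (Ram(G), 'Assume p > 2'), §2.4, §11.1, PilloniStroh2016 Cor 3.13, §3.11, §3.12.1, §3.15(1), Rem 1.10, Rem 2.9 (hal-01409532), FakhruddinPilloni2021 §9.2, proof of Thm 9.11 (arXiv:1910.03790 p.46): U(n) -> GU(n); Thm 9.10, HarrisLanTaylorThorneRMS2016 §1.3 (BC(Pi)_w), Lemma 1.1, Cor 1.3, p80140 Literature/NumberTheory/Automorphic/UnitaryCoherentGaloisRep.lean: GoldringKoskivirta2019_galoisRep_unitary (fact, 3 reviews: xl-apex; rank_zero + of_pos_rank proved), p86074 Summits/Langlands/Langlands/Theorems/QuadraticWindowHostInducedRepGkPlacewise.lean: stub_gkPlacewise_ratControl (consumer)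
[crux] PRINTED INPUT, promoted from the Literature named fact by the route-choice repair
(2026-08-16): Goldring–Koskivirta 2019 Thm 3.5.5 (LDS, unitary case) for Mok's quasi-split
U_{K/F₀}(N) — K/F₀ totally complex quadratic over totally real F₀ with involution cK ≠ 1, σ CUSPIDAL
on U_{K/F₀}(N) whose component at every real place is a NON-DEGENERATE LIMIT OF DISCRETE SERIES
(`UnitaryGroup.IsNondegenerateLimitOfDiscreteSeriesAt`, C-algebraicity built into `LDSDatum`), ℓ ∉
Ram(G) ∪ Ram(σ) (every place of K above ℓ unramified over ℚ and σ hyperspecial-unramified there): a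
continuous semisimple r : Γ_K → GL_N(ℚ̄_ℓ) unramified with arithmetic-Frobenius characteristic
polynomial `arithFrobPolyOfSatake ι q_u N β` (β = base-change Satake parameter, Mok's ξ₁) at every u
∤ ℓ over a RATIONAL prime p with K/ℚ unramified above p and σ unramified at every place above p (the
PRINTED control set, indexed by rational primes — Cruxes/HostInducedRep/Disproof.lean §6). The item
is VERBATIM (fully qualified) the body of
`Literature.NumberTheory.Automorphic.GoldringKoskivirta2019_galoisRep_unitary` (p80140; three
literature review seats 2026-08-16: faithful, `xl-apex`, not dischargeable inline, no decom -/
@[route_item "route-Langlands-QuadraticWindow"]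
def GaloisRepOfUnitaryLDS : Prop :=
  ∀ (F₀ K : Type) [Field F₀] [NumberField F₀] [Field K] [NumberField K] [Algebra F₀ K] (cK : K ≃ₐ[F₀] K), NumberField.IsTotallyReal F₀ → Module.finrank F₀ K = 2 → ∀ (hc : cK ≠ 1), NumberField.IsTotallyComplex K → ∀ (N : ℕ) (ℓ : ℕ) [Fact ℓ.Prime] (ι : PadicAlgCl ℓ ≃+* ℂ) (hcptK : Literature.NumberTheory.Automorphic.isCompact_glFiniteIntegralLevel N K) (σ : Literature.NumberTheory.Automorphic.UnitaryGroup.CuspidalAutomorphicRepData F₀ K cK N hcptK), (∀ (w : {w : NumberField.InfinitePlace K // w.IsComplex}) (hw : cK • w.1 = w.1), ∃ (p q : ℕ) (d : Literature.NumberTheory.Automorphic.LDSDatum p q), Literature.NumberTheory.Automorphic.UnitaryGroup.IsNondegenerateLimitOfDiscreteSeriesAt F₀ K cK N (Literature.NumberTheory.Automorphic.StdForm.antidiagonal N) hcptK σ.1 hw hc d) → (∀ u : IsDedekindDomain.HeightOneSpectrum (NumberField.RingOfIntegers K), ((ℓ : ℕ) : NumberField.RingOfIntegers K) ∈ u.asIdeal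 → u.asIdeal.ramificationIdx ℤ = 1 ∧ Literature.NumberTheory.Automorphic.UnitaryGroup.IsUnramifiedAt F₀ K cK N hcptK σ.1 u) → ∃ r : Literature.NumberTheory.GaloisRepresentations.FramedGaloisRep K (PadicAlgCl ℓ) N, r.toGaloisRep.IsSemisimple ∧ ∀ (u : IsDedekindDomain.HeightOneSpectrum (NumberField.RingOfIntegers K)) (β : Multiset ℂ), ((ℓ : ℕ) : NumberField.RingOfIntegers K) ∉ u.asIdeal → (∀ u' : IsDedekindDomain.HeightOneSpectrum (NumberField.RingOfIntegers K), u'.asIdeal.under ℤ = u.asIdeal.under ℤ → u'.asIdeal.ramificationIdx ℤ = 1 ∧ Literature.NumberTheory.Automorphic.UnitaryGroup.IsUnramifiedAt F₀ K cK N hcptK σ.1 u') → Literature.NumberTheory.Automorphic.UnitaryGroup.HasBaseChangeSatakeAt F₀ K cK N hcptK σ.1 u β → r.IsUnramifiedAt u ∧ r.HasFrobCharpolyAt u (Literature.NumberTheory.Automorphic.arithFrobPolyOfSatake ι u.residueCard N β)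

/-- item stmt-Langlands-15138 · crux · rank 6 · open · by planner
why it might fail: Formalization debt (XL: Arthur-Clozel Thm 4.2(e) = twisted trace formula, + Henniart Thm 5 local-global AI at EVERY unramified place; no local rep theory of GL_n(K_v) in the tree), not maths. False AS TYPED only by a slip in the every-place upgrade (inducedSatakePolynomial, f(w|v) roots).
sources: ArthurClozelAMS120 Ch.3 Thm 4.2(e), Thm 5.1, Def 6.1/(6.1)-(6.2), Thm 6.2 (proof, PDF p.185), Lemma 6.4, Henniart2012 §1.10, §1.12, Thm 3, Thm 5, §2.1, Prop 2.7 (doi:10.24033/bsmf.2622), p84234 Literature/NumberTheory/Automorphic/AutomorphicInductionCuspidalUnramified.lean: automorphicInduction_cyclic_cuspidal_unramified (fact; review-split g2: xl-apex), Literature/NumberTheory/Automorphic/AutomorphicInductionCuspidalUnramifiedProofs.lean: automorphicInduction_cyclic_cuspidal_unramified_of_leaves (residue R1/R2), p84505 Summits/Langlands/Langlands/Theorems/QuadraticWindowHostInducedRepInducedPackage.lean: stub_inducedPackage_of_automorphicInduction (consumer)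
[crux] PRINTED INPUT, promoted from the Literature named fact by the same route-choice repair (same
class, same crux, already consumed in the tree): CYCLIC AUTOMORPHIC INDUCTION OF PRIME DEGREE,
CUSPIDAL CASE, WITH THE HECKE–SATAKE RELATION AT EVERY UNRAMIFIED PLACE — for E/K Galois of prime
degree with cyclic group, n ≥ 1, π cuspidal on GL_n(𝔸_E) not Galois-stable in the Satake sense (`¬
IsGaloisStableSatakeAE K π.1`), there is a CUSPIDAL P on GL_{n[E:K]}(𝔸_K) such that at EVERY finite
place v of K unramified in E, if π has Satake parameter β_w at every w ∣ v then P has a Satake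
parameter α at v with ∏_{a∈α}(X − a) = ∏_{w∣v} ∏_{b∈β_w}(X^{f(w|v)} − b) (`satakePolynomial α =
inducedSatakePolynomial v β`; Arthur–Clozel Ch. 3 Thm 4.2(e) + Thm 5.1 + Thm 6.2/Lemma 6.4, Henniart
2012 Thm 3 + Thm 5). The item is VERBATIM (fully qualified) the body of
`Literature.NumberTheory.Automorphic.automorphicInduction_cyclic_cuspidal_unramified` (p84234;
literature review-split g2 2026-08-16: faithful, ESTABLISHED, `xl-apex`) — definitionally equal
(Sketch.lean `Iff.rfl`), so the landed `stub_inducedPackage_of_automorphicInduction :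
automorphicInduction_cyclic_cuspidal_unramified → …` (Theorems/Quad -/
@[route_item "route-Langlands-QuadraticWindow"]
def AutomorphicInductionUnramified : Prop :=
  ∀ (n : ℕ) (K E : Type) [Field K] [NumberField K] [Field E] [NumberField E] [Algebra K E] [IsGalois K E], IsCyclic (E ≃ₐ[K] E) → (Module.finrank K E).Prime → 0 < n → ∀ (hE : Literature.NumberTheory.Automorphic.isCompact_glFiniteIntegralLevel n E) (hK : Literature.NumberTheory.Automorphic.isCompact_glFiniteIntegralLevel (n * Module.finrank K E) K) (π : Literature.NumberTheory.Automorphic.CuspidalAutomorphicRepData n E hE), ¬ Literature.NumberTheory.Automorphic.IsGaloisStableSatakeAE K π.1 → ∃ P : Literature.NumberTheory.Automorphic.CuspidalAutomorphicRepData (n * Module.finrank K E) K hK, ∀ (v : IsDedekindDomain.HeightOneSpectrum (NumberField.RingOfIntegers K)) (β : IsDedekindDomain.HeightOneSpectrum (NumberField.RingOfIntegers E) → Multiset ℂ), Algebra.IsUnramifiedIn (NumberField.RingOfIntegers E) v.asIdeal → (∀ w : IsDedekindDomain.HeightOneSpectrum (NumberField.RingOfIntegers E), w.asIdeal.under (NumberField.RingOfIntegers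 K) = v.asIdeal → π.1.HasSatakeParamAt w (β w)) → ∃ α : Multiset ℂ, P.1.HasSatakeParamAt v α ∧ Literature.NumberTheory.Automorphic.satakePolynomial α = Literature.NumberTheory.Automorphic.inducedSatakePolynomial v β

/-- item stmt-Langlands-16407 · crux · rank 7 · open · by planner
why it might fail: Formalization debt (XL: Langlands–Shahidi theory of the Siegel Eisenstein series on U(n,n) + Kim's unitarity argument + JS for (π,π^c); none in Mathlib), not maths — at s=1 GS 4.3 needs no TF stabilisation (Rem 4.2, §4.C). As typed: a.e.-unitarity ‖det t_w‖=1 vs BJ 5.7 normalisation could slip.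
sources: GrbacShahidi2015 Thm 4.3 (1),(2)(a)-(b) pp.186/204; proof pp.204-206 (Thm 4.1 + Thm 2.1, identity (**)); Remark 4.2; Remark 4.4; §4.C (Kim's unitarity argument); §2.A (doi:10.2140/pjm.2015.276.185, read p0003, p0020-p0024), Mok2014 §2.5 (paragraph before Thm 2.5.4), Thm 2.5.4(a) (arXiv:1206.0882), ArthurClozelAMS120 Ch.3 (2.1)-(2.3) (Jacquet-Shalika for L^S(s, pi x pi')), JacquetShalikaAJM1981 Cor 2.5; Jacquet-Shalika 1981 II Prop 3.6, ShahidiAJM1981 Thm 5.1; Shahidi 2010 Thm 7.1.2 (non-constant term), Flicker1988 Theorem p.297, p.306, p.310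
[crux] PRINTED INPUT, promoted from the Literature named fact by the route-choice repair
(2026-08-16; third of its kind on this crux, after GaloisRepOfUnitaryLDS r5 and
AutomorphicInductionUnramified r6): GRBAC–SHAHIDI 2015 THM 4.3 (1), (2)(a)–(b) AT s = 1 FOR PARTIAL
ASAI L-FUNCTIONS, continuation form. E/F quadratic with automorphism c ≠ 1; π a cuspidal datum on
GL_N(𝔸_E), N ≥ 1, unitary a.e. (‖det t_{π,w}‖ = 1 for almost all w); (S, A) an Asai datum of π
(`IsAsaiDatum`); η a sign. Then there is σ₀ ≥ 1 with (i) the raw partial Asai Euler product ∏_{v∉S}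
det(1 − As^η(t_v) q_v^{−s})⁻¹ multipliable for Re s > σ₀, and (ii) k ≤ 1, δ > 0 and G holomorphic on
{1 < Re s} ∪ B(1,δ) with G = (s−1)^k · L^S(s, π, As^η) on Re s > σ₀ and G(1) ≠ 0 — at most a simple
pole at s = 1, non-zero leading coefficient, both signs, self-dual or not. The item is VERBATIM
(fully qualified) the body of
`Literature.NumberTheory.Automorphic.GrbacShahidi2015_partialAsaiL_at_one`
(AsaiSignContinuation.lean, p117412; judged xl-apex twice: not dischargeable by one literature seat,
facts are not split) — definitionally equal (planner Sketch.lean: `Iff.rfl`, lean check rc 0) —, so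
the LANDED consumers take `(h : Par -/
@[route_item "route-Langlands-QuadraticWindow"]
def PartialAsaiLAtOne : Prop :=
  ∀ (F E : Type) [Field F] [NumberField F] [Field E] [NumberField E] [Algebra F E] (c : E ≃ₐ[F] E), Module.finrank F E = 2 → c ≠ 1 → ∀ (N : ℕ) (hcpt : Literature.NumberTheory.Automorphic.isCompact_glFiniteIntegralLevel N E) (π : Literature.NumberTheory.Automorphic.CuspidalAutomorphicRepData N E hcpt), 0 < N → (∀ᶠ w : IsDedekindDomain.HeightOneSpectrum (NumberField.RingOfIntegers E) in Filter.cofinite, ∀ α : Multiset ℂ, π.1.HasSatakeParamAt w α → ‖α.prod‖ = 1) → ∀ (S : Set (IsDedekindDomain.HeightOneSpectrum (NumberField.RingOfIntegers F))) (A : Literature.NumberTheory.Automorphic.SatakeFamily E) (η : ℤˣ), π.1.IsAsaiDatum c S A → ∃ σ₀ : ℝ, 1 ≤ σ₀ ∧ (∀ s : ℂ, σ₀ < s.re → Multipliable fun v : {v : IsDedekindDomain.HeightOneSpectrum (NumberField.RingOfIntegers F) // v ∉ S} => ((Literature.NumberTheory.Automorphic.asaiLocalPolynomial c A η (Literature.NumberTheory.Automorphic.placeAbove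 E v.1)).eval ((v.1.residueCard : ℂ) ^ (-s)))⁻¹) ∧ ∃ (k : ℕ) (δ : ℝ) (G : ℂ → ℂ), k ≤ 1 ∧ 0 < δ ∧ DifferentiableOn ℂ G ({s : ℂ | 1 < s.re} ∪ Metric.ball 1 δ) ∧ (∀ s : ℂ, σ₀ < s.re → G s = (s - 1) ^ k * Literature.NumberTheory.Automorphic.partialAsaiL S c A η s) ∧ G 1 ≠ 0

/-- item stmt-Langlands-3202 · crux · rank 9 · open · by planner
why it might fail: Summit-strength modulo X (Langlands ↔ X ∧ BeyondTheWindow, p85108): GL_n reciprocity for every other (F,n,π), LGC at all places, de Rham, direction (B) — wide open (no ρ_π at all for non-polarizable π over non-CM F, n≥3); no engine; closes only with the summit; 3 prover verdicts open-problem.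
sources: BuzzardGeeLMS2014 Conj. 3.2.1-3.2.2 (the summit statement), Calegari2023 (arXiv:2109.14145) §12 fn 57: no Galois representations known for non-polarizable π over F neither CM nor totally real, n ≥ 3, FontaineMazurGeometric1995 Conj. 1 (direction (B)), p85108 Summits/Langlands/Langlands/Theorems/QuadraticWindowBeyondTheWindowSummitImpliesWindow.lean: langlands_iff_quadraticWindowA_and_beyondTheWindow, imp_langlands_iff_imp_beyondTheWindow, p83390 Summits/Langlands/Langlands/Theorems/QuadraticWindowBeyondTheWindow.lean: beyondTheWindow_sandwich, beyondTheWindow_iff_langlands, evidence stmt-Langlands-3202/BeyondTheWindow-assessment-gen2.md (prover verdicts open-problem gen-0/1/2)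
[support] RESIDUAL, NOT attacked by this route and not expected to be proved here: the rest of the
summit given the window theorem (all other (F, n, π); inside the window: primes ℓ dividing the
level, local–global compatibility at every finite place, de Rham at ℓ, irreducibility/uniqueness,
and direction (B) — the latter is the sibling card unitary-lds-patching-window). It is listed only
so that the assembly `HostInducedRep → TwistUnpackaging → BeyondTheWindow → Langlands` is an honest
implication whose mathematical content is exactly `cruxes ⟹ QuadraticWindowA` (pure logic, checked
in the planner's Sketch.lean). A sector route on an all-fields/all-ranks summit cannot do better;
refuters should grade the route on the target and the cruxes. -/
@[route_item "route-Langlands-QuadraticWindow", crux]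
def BeyondTheWindow : Prop :=
  QuadraticWindowA → Langlands

-- earlier TwistNormalization (stmt-Langlands-3201, replaced 2026-08-15T16:29:09Z -> stmt-Langlands-10904): retired by None — QuadraticWindowA → ∀ (F₀ F : Type) [Field F₀] [NumberField F₀] [Field F] [NumberField F] [Algebra F₀ F] (τ : F ≃ₐ[F₀] F), NumberField.IsTotallyReal F₀ → Module.finrank F₀ F = 2 → τ ≠ 1 → ∀ (n : ℕ) (hcpt : Literature.NumberTheory.Automorphic.isCompact_glFiniteIntegralLevel n F)
/-- item stmt-Langlands-10904 · support · rank 9 · closed · proved by Summit.Langlands.Langlands.Theorems.TwistNormalization_proof @ 0f9faae84f2a (prover) · by planner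
sources: ArthurClozelAMS120 Ch.3 §6, arXiv:1010.2561 §2.1 (parity conventions for polarized pairs), evidence stmt-Langlands-3254/SignLawParityEvidence.md (which parities occur; WLOG by twist)
[support] The parity normalisation in the target is WLOG (rev 3: all n). Given a τ-polarized π whose
polarization character has parity v ↦ η_v(−1) NOT constant on the real places of F₀ split in F (even
n; e.g. π = BC(Π)⊗λ with λ of mixed parity on one split pair, the reviewer's example) or not ≡ −1
there (odd n; e.g. every standard base change from U_{F/F₀}(n), where η = 1): twist π by a
finite-order Hecke character λ of F, unramified above ℓ, with λ_w(−1)λ_{τw}(−1) = −1 exactly at the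
offending pairs {w, τw} (exists: class field theory / weak approximation for characters with
prescribed signs and finitely many unramified conditions); π⊗λ is again cuspidal regular algebraic,
τ-polarized with η_λ = η·(λ|_{𝔸_{F₀}^×}) — parity at v multiplied by λ_w(−1)λ_{τw}(−1) — and not
τ-invariant for λ outside a finite set of bad twists (vary λ at an auxiliary split prime); apply the
target to π⊗λ (Artin avatar of the finite part of η_λ = e · avatar of λ|_{F₀}, same k) and untwist:
ρ_π = ρ_{π⊗λ} ⊗ λ̃⁻¹ (Sat(π⊗λ,w) = Sat(π,w)·λ(ϖ_w)). Formally the item is QuadraticWindowA →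
(QuadraticWindowA without the two parity hypotheses). Needs the accepted twist API
(`CuspidalAutomorphicRepData.twist`, Autom -/
@[route_item "route-Langlands-QuadraticWindow"]
def TwistNormalization : Prop :=
  QuadraticWindowA → ∀ (F₀ F : Type) [Field F₀] [NumberField F₀] [Field F] [NumberField F] [Algebra F₀ F] (τ : F ≃ₐ[F₀] F), NumberField.IsTotallyReal F₀ → Module.finrank F₀ F = 2 → τ ≠ 1 → ∀ (n : ℕ) (hcpt : Literature.NumberTheory.Automorphic.isCompact_glFiniteIntegralLevel n F) (π : Literature.NumberTheory.Automorphic.CuspidalAutomorphicRepData n F hcpt) (e : Literature.NumberTheory.GaloisRepresentations.FramedGaloisRep F₀ ℂ 1) (k : ℤ), π.1.IsRegularAlgebraic → (∀ᶠ w in Filter.cofinite, ∀ (α β : Multiset ℂ) (c : ℂ), π.1.HasSatakeParamAt w α → π.1.HasSatakeParamAt (τ • w) β → e.HasFrobCharpolyAt (w.under (NumberField.RingOfIntegers F₀)) (Polynomial.X - Polynomial.C c) → β = α.map (fun a ↦ a⁻¹ * (c * ((w.under (NumberField.RingOfIntegers F₀)).residueCard : ℂ) ^ k) ^ w.asIdeal.inertiaDeg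 (NumberField.RingOfIntegers F₀))) → (∃ᶠ w in Filter.cofinite, ∃ α β : Multiset ℂ, π.1.HasSatakeParamAt w α ∧ π.1.HasSatakeParamAt (τ • w) β ∧ β ≠ α) → ∀ (ℓ : ℕ) [Fact ℓ.Prime] (ι : PadicAlgCl ℓ ≃+* ℂ), ¬ ((ℓ : ℤ) ∣ NumberField.discr F) → (∀ w : IsDedekindDomain.HeightOneSpectrum (NumberField.RingOfIntegers F), ((ℓ : ℕ) : NumberField.RingOfIntegers F) ∈ w.asIdeal → π.1.IsUnramifiedAt w) → ∃ ρ : Literature.NumberTheory.GaloisRepresentations.FramedGaloisRep F (PadicAlgCl ℓ) n, ρ.toGaloisRep.IsSemisimple ∧ ∀ᶠ w in Filter.cofinite, ∀ α : Multiset ℂ, π.1.HasSatakeParamAt w α → ρ.IsUnramifiedAt w ∧ ρ.HasFrobCharpolyAt w (Literature.NumberTheory.Automorphic.arithFrobPolyOfSatake ι w.residueCard n α)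

/-- item stmt-Langlands-16559 · support · rank 9 · open · by planner
[support] GLUE (route-repair unused-crux, 2026-08-16): the route's three PRINTED-INPUT cruxes,
promoted onto HostInducedRep by the route-choice repair (GaloisRepOfUnitaryLDS r5 =
Goldring–Koskivirta 2019 Thm 3.5.5; AutomorphicInductionUnramified r6 = cyclic automorphic induction
with Hecke–Satake at every unramified place; PartialAsaiLAtOne r7 = Grbac–Shahidi 2015 Thm 4.3 at s
= 1), imply the host engine output HostInducedRep (the `closes` hypothesis). TRUE: it is weaker than
HostInducedRep (itself true under reciprocity). It carries no mathematics of its own — it is the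
typed edge that puts the printed inputs into the cone of `closes` (closes unchanged: HostInducedRep
→ TwistUnpackaging → BeyondTheWindow → Langlands). STATUS IN THE TREE: along line
one-transparent-pane the landed `Summit.Langlands.Langlands.Theorems.HostInducedRep_proof_eleven`
(Theorems/QuadraticWindowHostInducedRep.lean) proves HostInducedRep from
AutomorphicInductionUnramified + PartialAsaiLAtOne (each definitionally the named fact it was
promoted from, `Iff.rfl`) and NINE non-apex named facts — lang.S27
`exists_galoisRep_of_regularAlgebraic`, `FakhruddinPilloni2021_galoisRep_of_weaklyRegular_oddCont`,
`Jacquet -/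
@[route_item "route-Langlands-QuadraticWindow"]
def HostInducedRepOfPrintedInputs : Prop :=
  GaloisRepOfUnitaryLDS → AutomorphicInductionUnramified → PartialAsaiLAtOne → HostInducedRep

/-- item stmt-Langlands-3203 · assembly · rank 1 · closed · proved by Summit.Langlands.Langlands.Theorems.QuadraticWindow.Assembly_proof (prover) · by planner
[assembly] HostInducedRep → TwistUnpackaging → BeyondTheWindow → Langlands. Proof: apply
BeyondTheWindow to QuadraticWindowA, which follows from the two cruxes by instantiation (the
ψ-family hypothesis of TwistUnpackaging is discharged by HostInducedRep); term-mode proof recorded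
in the planner's Sketch.lean (`example : Assembly`). The glue carries no mathematics by design
(D-0019 thin route); depth will come from splitting HostInducedRep along SignLaw / Mok descent / GK
3.5.5 / patching once SignLaw is settled. -/
@[route_item "route-Langlands-QuadraticWindow"]
def Assembly : Prop :=
  HostInducedRep → TwistUnpackaging → BeyondTheWindow → Langlands

/-! D-0027 §2.1 — DECIDING THEOREM (planner-authored via `route open/edit --closes-file`; by planner-rbadge-Langlands-QuadraticWindow-e5a24734-g4-0 2026-08-15T16:29:09Z):
its hypotheses are this route's items and its conclusion the sub-problem Statement (glue_lint), and it elaborates with this file. -/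

@[closes "route-Langlands-QuadraticWindow"] theorem closes (host : HostInducedRep) (unpack : TwistUnpackaging) (beyond : BeyondTheWindow) : Langlands :=
  beyond fun F₀ F _ _ _ _ _ τ hTR hdeg hτ n hcpt π e k hreg hpol hpar hodd hnti ℓ _ ι hℓ hunr =>
    unpack F₀ F τ hTR hdeg hτ n hcpt π e k hreg hpol hpar hodd hnti ℓ ι hℓ hunr
      fun eψ h₁ h₂ h₃ => host F₀ F τ hTR hdeg hτ n hcpt π e k hreg hpol hpar hodd ℓ ι hℓ hunr eψ h₁ h₂ h₃

end Summit.Langlands.Langlands.Theses.QuadraticWindow
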